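import Literature.RepresentationTheory.Kovacevic2021.SU21BorelWallachTable
import Literature.RepresentationTheory.Kovacevic2021.SU21UnitarityRays
import Literature.RepresentationTheory.Kovacevic2021.SU21UnitarityCone
import Literature.RepresentationTheory.Kovacevic2021.SU21UnitarityNecessary
import HarnessLib

/-!
# Borel–Wallach VI Thm 4.12 (2) for `SU(2,1)` HOLDS on the Kovačević model: the cohomological modules are unitary

Continuation of `Literature.RepresentationTheory.Kovacevic2021.SU21BorelWallachTable` (the model
`kovacevicTable : SUn1Table 2` of Borel–Wallach's dictionary on the irreducible Kovačević `K`-type data modulo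
isomorphism, with `VI_4_11` proved and `unitary` proved only for `J_{0,0}`), `SU21UnitarityRays` (the four ray
modules `U(0,±6)`, `Z(±3)` are unitarizable), `SU21UnitarityCone` (`W(3,0)` is unitarizable) and
`SU21UnitarityNecessary` (`IsUnitarizable.of_equiv`: unitarizability is an isomorphism invariant).
[BorelWallach2000, VI Thm 4.12 (2)] (Kraljević): "The representations `J_{ij}`, `i + j ≤ n − 1`, are unitary";
the `D_i` are discrete series (VI 4.8).  [Kovacevic2021, §4 Thm 4, Thm 5] lists `U(0)`, `U(l,2t)`, `Z(s)`
(`|s| ≥ 2`), `W(r,s)` (`s+r+1 > 0 > s-r-1`) among the unitary modules.  Proved here: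

* `isUnitarizable_of_finrank_relCohomology_ne_zero` — **every irreducible Kovačević datum with some
  `H^q(𝔤𝔩₃, 𝔨; V) ≠ 0` is unitarizable** (BW VI 4.11 (1) + 4.12 (2) in datum form, via
  `exists_equiv_model_of_isIrreducible`);
* `kovacevicTable_VI_4_12 : kovacevicTable.VI_4_12` — the transcribed predicate `SUn1Table.VI_4_12` HOLDS on the
  model, so `SUn1Table.unitary_of_cohomological` is unconditional there (`kovacevicTable_unitary_of_cohomological`);
* `kovacevicTable_unitary_mk` — `unitary` of a class is unitarizability of any representative.

Theorems only; no named facts.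

## References

* A. Borel, N. Wallach (2000), VI 4.8 p. 131, Thm 4.11–4.12 pp. 132–133. [BorelWallach2000]
* D. Kovačević, Acta Math. Spalatensia 1 (2021) 105–125, §4 Thm 4, Thm 5. [Kovacevic2021]
-/

noncomputable section

open Module
open Literature.Algebra.Lie Literature.Algebra.Lie.ChevalleyEilenberg
open Literature.RepresentationTheory.BorelWallach2000

namespace Literature.RepresentationTheory.Kovacevic2021

-- Mathlib idiom (Mathlib/Algebra/Lie/OfAssociative.lean): commutator brackets on associative algebras; needed for
-- the `𝔤𝔩(3,ℂ)`-module structure on `𝒟.V`, as in every file of this directory.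
attribute [local instance 100] LieRing.ofAssociativeRing

namespace SU21Datum

/-! ## §1 Cohomological irreducible data are unitarizable -/

/-- the six model modules are unitarizable [cite: Kovacevic2021, §4 Thm 4] [cite: BorelWallach2000, VI Thm 4.12 (2)] -/
theorem isUnitarizable_six :
    trivialMod.IsUnitarizable ∧ holDS.IsUnitarizable ∧ antiholDS.IsUnitarizable ∧ ladderPlus.IsUnitarizable ∧
      ladderMinus.IsUnitarizable ∧ midDS.IsUnitarizable :=
  ⟨trivialMod_isUnitarizable, holDS_isUnitarizable, antiholDS_isUnitarizable, ladderPlus_isUnitarizable,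
    ladderMinus_isUnitarizable, midDS_isUnitarizable⟩

/-- **An irreducible `K`-type datum with non-zero `(𝔤𝔩₃, 𝔨)`-cohomology is unitarizable** ("cohomological
⇒ unitary" for `SU(2,1)`: BW VI Thm 4.11 (1) with Thm 4.12 (2), in Kovačević datum form).
[cite: BorelWallach2000, VI Thm 4.11 (1), Thm 4.12 (2)] [cite: Kovacevic2021, §4 Thm 4, Thm 5] -/
theorem isUnitarizable_of_finrank_relCohomology_ne_zero (𝒟 : SU21Datum) [LieModule.IsIrreducible ℂ gl3 𝒟.V]
    {q : ℕ} (hq : finrank ℂ (relCohomology ℂ gl3 𝒟.V kSub q) ≠ 0) : 𝒟.IsUnitarizable := by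
  obtain ⟨T, hT, -, ⟨e⟩⟩ := 𝒟.exists_equiv_model_of_isIrreducible hq
  refine IsUnitarizable.of_equiv e ?_
  rcases hT with rfl | rfl | rfl | rfl | rfl | rfl
  exacts [trivialMod_isUnitarizable, holDS_isUnitarizable, antiholDS_isUnitarizable, ladderPlus_isUnitarizable,
    ladderMinus_isUnitarizable, midDS_isUnitarizable]

/-! ## §2 Borel–Wallach VI Thm 4.12 (2) on the model -/

/-- `unitary` of the class of a datum is unitarizability of the datum (an isomorphism invariant).
[cite: BorelWallach2000, VI Thm 4.12] -/
theorem kovacevicTable_unitary_mk (𝒟 : SU21Datum) (h : LieModule.IsIrreducible ℂ gl3 𝒟.V) :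
    kovacevicTable.unitary (IrrMod.mk 𝒟 h) ↔ 𝒟.IsUnitarizable := by
  constructor
  · rintro ⟨b, hb, hbU⟩
    obtain ⟨e⟩ : Nonempty (b.1.V ≃ₗ⁅ℂ, gl3⁆ 𝒟.V) := Quotient.exact hb
    exact IsUnitarizable.of_equiv e.symm hbU
  · intro hU
    exact ⟨⟨𝒟, h⟩, rfl, hU⟩

/-- **Borel–Wallach VI Theorem 4.12 (2) HOLDS for the Kovačević model**: the `J_{ij}` (`i + j ≤ 1`:
`U(0)`, `Z(3)`, `Z(-3)`) and the discrete series `D_0, D_1, D_2` (`U(0,-6)`, `W(3,0)`, `U(0,6)`) are unitary.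
[cite: BorelWallach2000, VI Thm 4.12 (2) p. 133, VI 4.8 p. 131] [cite: Kovacevic2021, §4 Thm 4, Thm 5] -/
theorem kovacevicTable_VI_4_12 : kovacevicTable.VI_4_12 := by
  refine ⟨fun i j h => ?_, fun i => ?_⟩
  · rcases i with _ | i
    · rcases j with _ | j
      · exact ⟨⟨trivialMod, trivialMod_isIrreducible⟩, rfl, trivialMod_isUnitarizable⟩
      · exact ⟨⟨ladderMinus, ladderMinus_isIrreducible⟩, rfl, ladderMinus_isUnitarizable⟩
    · exact ⟨⟨ladderPlus, ladderPlus_isIrreducible⟩, rfl, ladderPlus_isUnitarizable⟩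
  · fin_cases i
    · exact ⟨⟨antiholDS, antiholDS_isIrreducible⟩, rfl, antiholDS_isUnitarizable⟩
    · exact ⟨⟨midDS, midDS_isIrreducible⟩, rfl, midDS_isUnitarizable⟩
    · exact ⟨⟨holDS, holDS_isIrreducible⟩, rfl, holDS_isUnitarizable⟩

/-- **Hence "cohomological ⇒ unitary" is unconditional on the model**: every class with some `H^q ≠ 0` is
unitary (`SUn1Table.unitary_of_cohomological` with both hypotheses discharged).
[cite: BorelWallach2000, VI Thm 4.11 (1), Thm 4.12 (2)] -/
theorem kovacevicTable_unitary_of_cohomological {V : IrrMod} (hV : kovacevicTable.Cohomological V) :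
    kovacevicTable.unitary V :=
  kovacevicTable.unitary_of_cohomological kovacevicTable_VI_4_11 kovacevicTable_VI_4_12 hV

/-- in particular all six labelled classes `J_{00}, J_{10}, J_{01}, D_0, D_1, D_2` of the model are unitary and these
are all the cohomological classes [cite: BorelWallach2000, VI 4.8, Thm 4.11 (1), Thm 4.12 (2)] -/
theorem kovacevicTable_cohomological_imp_unitary (V : IrrMod) :
    kovacevicTable.Cohomological V →
      ((∃ i j h, V = kovacevicTable.J i j h) ∨ ∃ i, V = kovacevicTable.D i) ∧ kovacevicTable.unitary V :=
  fun hV => ⟨kovacevicTable_VI_4_11.1 V hV, kovacevicTable_unitary_of_cohomological hV⟩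

end SU21Datum

end Literature.RepresentationTheory.Kovacevic2021
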